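import Summits.QuantumFields.QCD.Theorems.NestedDissectionSeaEarlyCrosserLawNormalFormLinks
import Summits.QuantumFields.QCD.Theorems.NestedDissectionSeaEarlyCrosserLawStubDiracKato
import Summits.QuantumFields.QCD.Theorems.NestedDissectionSeaEarlyCrosserLawStubWeitzenbockDivergence
import Summits.QuantumFields.QCD.Theorems.NestedDissectionSeaEarlyCrosserLawStubKatoSobolevCutoff
import Summits.QuantumFields.QCD.Theorems.NestedDissectionSeaEarlyCrosserLawStubSobolevFourR4
import Summits.QuantumFields.QCD.Theorems.NestedDissectionSeaEarlyCrosserLawStubFloorAssembly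
import Literature.MathematicalPhysics.QuantumLattice.YangMillsClassical
import HarnessLib.Audit

/-!
# Line `zero-mode-floor-dilute-gas` for crux `NestedDissectionSea.EarlyCrosserLaw`
# — skeleton v3 (lead c7, seat prover-line-stmt-QuantumFields-13995-c7-0, 2026-08-17)

v3 (lead c7): v2's analytic stub S2 `stub_zeroModeActionFloor` is RESHAPED at the skeleton level into three registered
stubs with the same composition — S2e `stub_weitzenbockDivergence` (pointwise Weitzenböck divergence identity for
Dirac-harmonic spinors: pure `fderiv` calculus), S2f `stub_katoSobolevCutoff` (cut-off Kato–Sobolev bound, given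
S2a + S2b: smoothing of `|ψ|`, monotone convergence) and S2g `stub_floorAssembly` (S2e → S2f-conclusion → floor:
cut-offs, chirality/Clifford/duality algebra, `L²` Cauchy–Schwarz, `R → ∞`; held by the lead) — and v2's S2 statement
is now the sorry-free composition `zeroModeActionFloor_of` (byte-identical statement, still S3's hypothesis).  Stub
count 7 = stubs_max: S1 (input), S2a (Literature fact), S2b, S2e, S2f, S2g, S3 (crux-sized).  Conventions of S2e/S2f/S2g
(`∇_μ = ∂_μ + A_μ`, `F_μν = curvature A x e_μ e_ν`, `𝔉 = Σ_{μ<ν} γ_μγ_ν ⊗ F_μν`, chirality blocks, duality identities)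
were checked exactly on random polynomial data before registration.

v3.1 (lead c7): S2b `stub_diracKato` LANDED p139359, S2e `stub_weitzenbockDivergence` LANDED p140239, S2f
`stub_katoSobolevCutoff` LANDED p139929 — their declarations are now IMPORTED (same fully-qualified names) and no longer
carry a `sorry` here; open stubs: S1 (input), S2a (Literature fact), S2g (lead), S3 (crux-sized).

v3.2 (lead c7): S2a `stub_sobolevFourR4` LANDED p141140 — the sharp Sobolev inequality on `ℝ⁴` is PROVED in the tree
(`Literature.Geometry.Riemannian.sharp_sobolev_euclidean_four`, Cordero-Erausquin–Nazaret–Villani/Maggi mass transport with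
the Knothe map), so the floor no longer leans on any unproved fact; open stubs: S1 (input), S2g (lead; proof written, landing), S3.

v3.3 (lead c7): S2g `stub_floorAssembly` LANDED — the zero-mode action floor `zeroModeActionFloor_of` (v2's S2, S3's
hypothesis) is now an UNCONDITIONAL theorem of the tree (modulo nothing).  Open stubs: S1 `stub_pinnedPhysicalLine` (N1, the
parity pin — summit-grade input) and S3 `stub_diluteOfActionFloor` (N2 given the floor — crux-sized); neither is worker-sized.

(Below: the strategist's v2 header, unchanged.)  Crux stmt-QuantumFields-13995, rank 2 of
route-QuantumFields-NestedDissectionSea — strategist skeleton v2.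

Crux-strategist (WALL-BREAKER on the EXHAUSTED chain; seat `planner-cstrat-stmt-QuantumFields-13995-p1-0`,
2026-08-17).  Line card: `Lines/zero-mode-floor-dilute-gas.md`; census: `STRATEGY-CENSUS.md`.
v2 (same seat, same day): the analytic stub S2 of v1 is cut into its three honest parts — the one deep KNOWN theorem
it needs (S2a sharp Sobolev on `ℝ⁴`, Talenti 1976: to be vendored as a Literature fact), a finite-dimensional
Dirac–Kato inequality (S2b, closable now), and the floor GIVEN those two (S2, closable with real but finite work) — so
that workers have two closable stubs and the external input is named; the action is written in the COORDINATE frame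
(`ymDensityOfBasis (EuclideanSpace.basisFun (Fin 4) ℝ)`), removing v1's frame mismatch with `ymAction`.

## Why a fourth line, and what it does NOT claim

Eight lead seats and three built lines (`accretive-coarse-jensen`, `kac-rice-hermitian-dos`,
`cells-inherit-torus-extinction`) left, line-independently, the SAME two-piece residual (master certificate
`Lines/cells-inherit-torus-extinction-dead.md` §2–§4, kernel-checked: the pin is necessary — `pinnedLine_of_earlyCrosserLaw`
p105530 —, it is the only load-bearing clause — `LowerPinLoadBearing` —, and the crux in normal form is "pin +
cover-probability law at the same regularisation" — p121074/p134627):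

* N1 = the two-sided parity pin on the physical branch (`∃ reg`), and
* N2 = window dilution of early crossers along every pinned branch regularisation (`∀ reg`, conditional).

The strategist's decomposition `EarlyCrosserLaw_of_subs : N1 → N2 → EarlyCrosserLaw` is kernel-checked (crux workfile
`EarlyCrosserLawSplit.lean`, evidence `Split.lean`; `route edit --split` itself is final-cycle-only, the payload is in
`SPLIT-CHILDREN.md`).  THIS LINE does not dodge N1 — nothing can: N1 is topological-charge parity on physical tori in
the continuum limit, a non-perturbative input of summit grade, carried VERBATIM as the input stub S1.  What the line
changes is the cut of the (a′)-side N2: instead of one more ∀-reg probabilistic law at pinned data (mean count /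
pseudospectral cover / torus inheritance — each ≡ N2 in difficulty), it isolates the ONE finite piece of new
mathematics that every accounting of N2 needs and that the standing disprover named as THE sharp target of the crux
(Disproof.lean §5.5; TRIAGE-r1-2: "the lead should file it as the first analytic stub") — the ZERO-MODE ACTION FLOOR —
as a theorem of analysis on flat `ℝ⁴` (S2a + S2b ⊢ S2), and states the remaining semiclassical upper bound CONDITIONALLY
on it (S3).

## Stubs

* S1 `stub_pinnedPhysicalLine` — N1 verbatim.  INPUT, summit-grade; no worker is to be waved on it.
* S2a `stub_sobolevFourR4` — the sharp `L⁴`-Sobolev inequality on `ℝ⁴` for smooth compactly supported real functions,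
  `(∫f⁴)^{1/2} ≤ (√6/8π)·∫‖df‖²` (Talenti 1976 doi:10.1007/bf02418013 / Aubin 1976; `(√6/8π) = 0.09747`).  KNOWN THEOREM,
  deep to formalise (Bliss lemma + symmetrisation, or Lieb's sharp HLS): vendor as a Literature named fact
  (`kind=definition`, cite) and DISCHARGE when formalised; the line is conditional on it until then.  Any constant
  `< 0.1218` would do (S2's chain with S2b's 4/5); the classical Gagliardo–Nirenberg product proof gives ≈ 0.25 — not enough.
* S2b `stub_diracKato` — pointwise Dirac–Kato inequality, PURE FINITE-DIMENSIONAL ALGEBRA over `euclideanGamma`: if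
  `Σ_μ γ_μ v_μ = 0` (`v_μ ∈ ℂ⁴ ⊗ ℂ³`) then `Σ_μ (Re⟨u, v_μ⟩)² ≤ (4/5)‖u‖² Σ_μ‖v_μ‖²`.  Proof (3 lines): with `û = u/‖u‖`,
  `a_μ = Re⟨û,v_μ⟩`, `w_μ = v_μ − a_μû`: `Σ‖v_μ‖² = Σa_μ² + Σ‖w_μ‖²`; Clifford gives `‖(Σa_μγ_μ)û‖ = |a|`, and
  `(Σa_μγ_μ)û = −Σγ_μw_μ` has norm `≤ Σ‖w_μ‖ ≤ 2(Σ‖w_μ‖²)^{1/2}`, so `|a|² ≤ 4(Σ‖v‖² − |a|²)`.  (The refined Kato constant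
  `3/4` of Calderbank–Gauduchon–Herzlich would give κ ≥ 0.79; `4/5` already gives 0.69.)  Size M.
* S2 `stub_zeroModeActionFloor` — S2a-statement → S2b-statement → `∃ κ > 4/9`: every smooth `𝔰𝔲(3)`-valued connection
  `A` on `ℝ⁴` (tree `Connection`, `curvature`; Frobenius norm on `M₃(ℂ)`) with finite coordinate-frame action
  (`Integrable (ymDensityOfBasis (EuclideanSpace.basisFun (Fin 4) ℝ) A)`; the BPST instanton has action `8π²` in this
  normalisation) and ZERO topological charge (`∫ Re tr(F₀₁F₂₃ − F₀₂F₁₃ + F₀₃F₁₂) = 0`, integrand integrable) that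
  admits a smooth, square-integrable, somewhere-nonzero solution of the twisted Dirac equation `Σ_μ γ_μ(∂_μ + A_μ)ψ = 0`
  (tree `euclideanGamma`, colour action on the `Fin 3` index) has `κ·8π² ≤ ∫ ymDensityOfBasis … A`.  PAPER PROOF
  (census App. A, with S2b's 4/5 in place of 3/4): flat Weitzenböck `∫χ²|∇ψ|² = ∫χ²⟨ψ,𝔉ψ⟩ + absorbable` (so `∇ψ ∈ L²`
  is a conclusion), chirality (`γ₅ = γ₀γ₁γ₂γ₃ = diag(1,1,−1,−1)`: on each chirality only `F⁺` or only `F⁻` acts, as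
  `2Σ_aJ_a ⊗ F^±_{0a}`), Clifford norm `‖𝔉|‖²_op ≤ 6|F^±|²`, `∫|F^±|² = ½·action` AT `Q = 0`, then S2a on `f = |ψ_±|`
  (smoothed and cut off) and S2b: `‖𝔉|‖_{L²} ≥ 5/(4·0.09747) = 12.83`, `∫‖𝔉|‖² ≥ 164.5`, `3·action ≥ 164.5`,
  `action ≥ 54.8 = 0.694·8π² > (4/9)·8π² = 35.1`.  Size L (fderiv calculus for the Weitzenböck identity, explicit
  `4 × 4` gamma algebra, cut-off absorption, smoothing of `|ψ|`).
* S3 `stub_diluteOfActionFloor` — (the floor, S2's conclusion) → N2 verbatim: GIVEN the floor, early crossers are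
  window-dilute along every pinned physical-branch regularisation.  The rigorous form of the disprover's dilute-gas
  accounting (Disproof §5.4: a carrier species of action `κ·8π²` contributes `a^{bκ+b′−4}` per physical volume,
  `b = 11 − 2N_f/3`; instantons `b − 4 = 5, 17/3 > 0`; the floor `κ > 4/9 ≥ 4/b` closes the `Q = 0` zero-mode-pair
  loophole, `Q ≠ 0` species cost `≥ 8π²|Q|` by Bogomolny): Bałaban-grade renormalised semiclassics for rough lattice
  fields.  OPEN, crux-sized — the honest residual of the (a′) side.

Composition `EarlyCrosserLaw_of`: floor := S2 S2a S2b; N2 := S3 floor; N1 := S1; then the strategist's glue (inlined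
from `EarlyCrosserLawSplit.lean`).

## Disproof.lean (cdisprove-13995-0, v7; NO KILL, no `-- Targets`) — honoured

`trivial_without_lowerPin` (every proof must use (b)): S1 carries (b) and the composition uses it for BOTH pins of the
crux and as the hypothesis that un-vacuates S3's N2.  §3 `lowerPin_forces_mcrit_le` / `pin_window`: inside S1/N2.
§4/§4b (`μ′ = −4` on even cells, `EvenCellSingular`): N2 is stated on the physical BRANCH (`m_crit → 0`), where no
valence line reaches `−4`.  §5.5 IS S2 (the disprover's 0.22 becomes 0.69 with the `Q = 0` halving and S2b).
Negatives `JensenDilutionWithoutLowerPin`: not instantiated — N2 is conditional on the pins.  No stub is an instance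
of a landed Negative lemma.
-/

noncomputable section

open scoped BigOperators Classical Matrix Matrix.Norms.Frobenius
open Filter MeasureTheory
open Literature.MathematicalPhysics.QuantumLattice Literature.MathematicalPhysics.QuantumFieldTheory
  Literature.Probability.LatticeModels
open Summit.QuantumFields.QCD.Theses.NestedDissectionSea

namespace Summit.QuantumFields.QCD.Cruxes.EarlyCrosserLaw.ZeroModeFloorDiluteGas

/-! ## §1 Registered stubs (`sorry` lives only here) -/

/-- **S1 `stub_pinnedPhysicalLine` — N1, the two-sided parity pin on the physical branch (INPUT; summit-grade;
shared physics node of every line of this crux and of `FrameAndSeparatorLaw` (α), `LightQuarkCompletion`,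
`SpectralDefectExtinction.WindowExtinction`).**  For `N_f ∈ {2,3}`: ONE admissible `reg` (HasMassScaling,
HasAsymptoticScaling) with `m_crit(k) → 0`, a threshold `M₀ ≥ 0`, and for every sea tuple `m > M₀` some `R > 0`
with, for every `M > M₀`, eventually in `k`: (b) `P_pq[Re det D_W(m_crit − a_kM/Z_m) < 0] ≥ 1/4` on every odd
torus of side `≥ R`; (b″) `… (m_crit + a_kM/Z_m) … ≤ 1/8` on odd tori of side in `[R, 2R]`.  VERBATIM clauses
(b) ∧ (b″) of the crux (registered `stub_pinnedLineOnBranch` of skeleton v5, measure spelled as in the crux).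
Content: topological-charge parity `P(Q odd) ≥ 1/4` on physical tori surviving the continuum limit (b) and
Mohler–Schaefer's `⟨n_neg⟩ → 0` at fixed physical volume (b″).  NECESSARY for the crux (p105530) and its only
load-bearing clause (`LowerPinLoadBearing`).  No constructive handle is known (restriction + Jensen is short by
`e^{−4π²β_k}`: TRIAGE-r1-3 on `local-tunnelling-telescoping`); do NOT wave workers on it.  Size: open
(summit-grade input).  Leans on: `wilsonDirac`, `fermionDet`, `wilsonMeasure`, `QCDRegularisation`;
MohlerSchaefer2020, EdwardsHellerNarayanan1998, Luscher1982Topology. -/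
theorem stub_pinnedPhysicalLine :
    ∀ Nf : ℕ, (Nf = 2 ∨ Nf = 3) → ∃ reg : QCDRegularisation Nf, reg.HasMassScaling ∧ (reg.scheme 0 0 0).HasAsymptoticScaling ∧ Filter.Tendsto reg.mcrit Filter.atTop (nhds 0) ∧ ∃ M₀ : ℝ, 0 ≤ M₀ ∧ ∀ m : Fin Nf → ℝ, (∀ f, M₀ < m f) → ∃ R : ℝ, 0 < R ∧ (∀ M : ℝ, M₀ < M → ∀ᶠ k : ℕ in Filter.atTop, ∀ S : ℕ, R ≤ reg.a k * (2 * S + 1) → (1 / 4 : ℝ) ≤ (∫ U, (if (fermionDet (wilsonDirac (fundamentalRep (Fin 3)) U (reg.mcrit k - reg.a k * M / reg.Zm k) 1)).re < 0 then (1 : ℝ) else 0) * (∏ f, ‖fermionDet (wilsonDirac (fundamentalRep (Fin 3)) U (reg.mcrit k + reg.a k * m f / reg.Zm k) 1)‖) ∂(wilsonMeasure (d := 4) (L := 2 * S + 1) (fundamentalRep (Fin 3)) (reg.β k))) / (∫ U, (∏ f, ‖fermionDet (wilsonDirac (fundamentalRep (Fin 3)) U (reg.mcrit k + reg.a k * m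 f / reg.Zm k) 1)‖) ∂(wilsonMeasure (d := 4) (L := 2 * S + 1) (fundamentalRep (Fin 3)) (reg.β k)))) ∧ (∀ M : ℝ, M₀ < M → ∀ᶠ k : ℕ in Filter.atTop, ∀ S : ℕ, R ≤ reg.a k * (2 * S + 1) → reg.a k * (2 * S + 1) ≤ 2 * R → (∫ U, (if (fermionDet (wilsonDirac (fundamentalRep (Fin 3)) U (reg.mcrit k + reg.a k * M / reg.Zm k) 1)).re < 0 then (1 : ℝ) else 0) * (∏ f, ‖fermionDet (wilsonDirac (fundamentalRep (Fin 3)) U (reg.mcrit k + reg.a k * m f / reg.Zm k) 1)‖) ∂(wilsonMeasure (d := 4) (L := 2 * S + 1) (fundamentalRep (Fin 3)) (reg.β k))) / (∫ U, (∏ f, ‖fermionDet (wilsonDirac (fundamentalRep (Fin 3)) U (reg.mcrit k + reg.a k * m f / reg.Zm k) 1)‖) ∂(wilsonMeasure (d := 4) (L := 2 * S + 1) (fundamentalRep (Fin 3)) (reg.β k))) ≤ (1 / 8 : ℝ)) := by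
  sorry

-- `stub_sobolevFourR4`: LANDED p141140 (imported from the Theorems tree; it turned out to be PROVED in the tree already —
-- `Literature.Geometry.Riemannian.sharp_sobolev_euclidean_four`, mass transport — so S2a is no longer an external input).

-- `stub_diracKato`: LANDED (imported from the Theorems tree; see header).

-- `stub_weitzenbockDivergence`: LANDED (imported from the Theorems tree; see header).

-- `stub_katoSobolevCutoff`: LANDED (imported from the Theorems tree; see header).

-- `stub_floorAssembly`: LANDED (imported from the Theorems tree; file `…StubFloorAssembly.lean`, helpers `…ZeroModeEnergy`,
-- `…ZeroModeCurvTerm`, `…ZeroModeFloorLemmas`, `…ZeroMode{Clifford,Duality,Bochner,Cutoff,Regularity,Pointwise,Holder,Chirality}`).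

/-! ## §1b The floor, composed (sorry-free; was the registered stub `stub_zeroModeActionFloor` of v2, same statement) -/

/-- **S2 (v2's `stub_zeroModeActionFloor`, now composed): the zero-mode action floor on flat `ℝ⁴` GIVEN S2a and S2b**, from
S2e, S2f, S2g: `floor := S2g S2e (S2f S2a S2b)`.  Statement byte-identical to v2's stub (it is S3's hypothesis). -/
theorem zeroModeActionFloor_of :
    (∀ f : EuclideanSpace ℝ (Fin 4) → ℝ, ContDiff ℝ ((⊤ : ℕ∞) : WithTop ℕ∞) f → HasCompactSupport f → Real.sqrt (∫ x, f x ^ 4) ≤ (Real.sqrt 6 / (8 * Real.pi)) * ∫ x, ‖fderiv ℝ f x‖ ^ 2) →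
    (∀ (u : Fin 4 → Fin 3 → ℂ) (v : Fin 4 → Fin 4 → Fin 3 → ℂ), (∀ s c, ∑ μ : Fin 4, ∑ s' : Fin 4, euclideanGamma μ s s' * v μ s' c = 0) → ∑ μ : Fin 4, (∑ s, ∑ c, starRingEnd ℂ (u s c) * v μ s c).re ^ 2 ≤ (4 / 5 : ℝ) * (∑ s, ∑ c, ‖u s c‖ ^ 2) * ∑ μ : Fin 4, ∑ s, ∑ c, ‖v μ s c‖ ^ 2) →
    ∃ κ : ℝ, 4 / 9 < κ ∧ ∀ (A : Connection (EuclideanSpace ℝ (Fin 4)) (Matrix (Fin 3) (Fin 3) ℂ)) (ψ : EuclideanSpace ℝ (Fin 4) → Fin 4 → Fin 3 → ℂ), IsSmoothConnection A → (∀ x v, (A x v)ᴴ = -(A x v) ∧ (A x v).trace = 0) → Integrable (ymDensityOfBasis (EuclideanSpace.basisFun (Fin 4) ℝ) A) → Integrable (fun x => (((curvature A x (EuclideanSpace.single (0 : Fin 4) (1 : ℝ)) (EuclideanSpace.single (1 : Fin 4) (1 : ℝ))) * (curvature A x (EuclideanSpace.single (2 : Fin 4) (1 : ℝ)) (EuclideanSpace.single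 (3 : Fin 4) (1 : ℝ)))).trace - ((curvature A x (EuclideanSpace.single (0 : Fin 4) (1 : ℝ)) (EuclideanSpace.single (2 : Fin 4) (1 : ℝ))) * (curvature A x (EuclideanSpace.single (1 : Fin 4) (1 : ℝ)) (EuclideanSpace.single (3 : Fin 4) (1 : ℝ)))).trace + ((curvature A x (EuclideanSpace.single (0 : Fin 4) (1 : ℝ)) (EuclideanSpace.single (3 : Fin 4) (1 : ℝ))) * (curvature A x (EuclideanSpace.single (1 : Fin 4) (1 : ℝ)) (EuclideanSpace.single (2 : Fin 4) (1 : ℝ)))).trace).re) → ∫ x, (fun x => (((curvature A x (EuclideanSpace.single (0 : Fin 4) (1 : ℝ)) (EuclideanSpace.single (1 : Fin 4) (1 : ℝ))) * (curvature A x (EuclideanSpace.single (2 : Fin 4) (1 : ℝ)) (EuclideanSpace.single (3 : Fin 4) (1 : ℝ)))).trace - ((curvature A x (EuclideanSpace.single (0 : Fin 4) (1 : ℝ)) (EuclideanSpace.single (2 : Fin 4) (1 : ℝ))) * (curvature A x (EuclideanSpace.single (1 : Fin 4) (1 : ℝ)) (EuclideanSpace.single (3 : Fin 4) (1 : ℝ)))).trace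 + ((curvature A x (EuclideanSpace.single (0 : Fin 4) (1 : ℝ)) (EuclideanSpace.single (3 : Fin 4) (1 : ℝ))) * (curvature A x (EuclideanSpace.single (1 : Fin 4) (1 : ℝ)) (EuclideanSpace.single (2 : Fin 4) (1 : ℝ)))).trace).re) x = 0 → ContDiff ℝ ((⊤ : ℕ∞) : WithTop ℕ∞) ψ → Integrable (fun x => ∑ s, ∑ c, ‖ψ x s c‖ ^ 2) → (∃ x, ψ x ≠ 0) → (∀ x s c, ∑ μ : Fin 4, ∑ s' : Fin 4, euclideanGamma μ s s' * (fderiv ℝ (fun y => ψ y s' c) x (EuclideanSpace.single μ (1 : ℝ)) + ∑ c' : Fin 3, A x (EuclideanSpace.single μ (1 : ℝ)) c c' * ψ x s' c') = 0) → κ * (8 * Real.pi ^ 2) ≤ ∫ x, ymDensityOfBasis (EuclideanSpace.basisFun (Fin 4) ℝ) A x :=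
  fun hS hK => stub_floorAssembly stub_weitzenbockDivergence (stub_katoSobolevCutoff hS hK)

/-- **S3 `stub_diluteOfActionFloor` — given the floor, early crossers are window-dilute along every pinned
physical-branch regularisation (OPEN; crux-sized; the honest residual of the (a′) side = N2 conditioned on the
floor).**  Hypothesis: the floor (S2's conclusion) verbatim.  Conclusion: N2 verbatim — for `N_f ∈ {2,3}`, EVERY
admissible `reg` on the physical branch and every `M₀ ≥ 0` admit `b₀ ≥ 2`, `ℓ > 0`, `C ≥ 0` such that at every `(m, R)`
with `m_f > M₀ + C`, `R > 0` at which the pins (b), (b″) hold (threshold `M₀`), clause (a′) of the crux holds at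
`(b₀, ℓ, m, R)`.  Why plausibly true: the dilute-gas accounting of Disproof §5.4 — kinematics (KineticEdge: only
covariantly smooth carriers of lattice size `≥ π(2/|m_c|)^{1/2} → ∞` can cross early), smooth carriers cross LATE by
`c/ρ²` (Weitzenböck) so early crossing is a first-order upward fluctuation `(ρa_kΛ)^{b′}`, a species of action `κ·8π²`
has density `a_k^{bκ+b′−4}` per physical volume with `b = 11 − 2N_f/3`, instantons give `b − 4 = 5, 17/3 > 0`, and the
floor (`κ > 4/9 ≥ 4/b`) excludes the only sub-threshold species (a `Q = 0` zero-mode pair); data `⟨n_neg⟩ ∝ a^{6.8}`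
(MohlerSchaefer2020).  Why it might fail: a NON-smooth, non-topological carrier population of intermediate size in
the kinematic window `[E₀(−Δ_U/2), |m_c|]` (Disproof §5.1), or pair-collision carriers with an Aoki-type band `∝ a`;
and the proof needs renormalised semiclassics for rough lattice fields (small/large-field decomposition to the
window scale, carrier extraction by Uhlenbeck-type compactness + spectral convergence of Wilson–Dirac cells to
`D̸_A`, lattice index modes) — Bałaban-grade, beyond print.  Size: open (crux-sized).  Leans on: the floor;
`wilsonCell`, `kineticEdge_zeroMode`, `ChiralityPairing`, NormalForm (`dilutionClause_iff_coverProbClause`),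
Negative/* (CellPositivityDomain, EvenCellSingular); EdwardsHellerNarayananInstanton1998, tHooft1976, Weinberg2012,
Balaban1989LargeFieldII, Uhlenbeck1985, GoltermanShamir2003. -/
theorem stub_diluteOfActionFloor :
    (∃ κ : ℝ, 4 / 9 < κ ∧ ∀ (A : Connection (EuclideanSpace ℝ (Fin 4)) (Matrix (Fin 3) (Fin 3) ℂ)) (ψ : EuclideanSpace ℝ (Fin 4) → Fin 4 → Fin 3 → ℂ), IsSmoothConnection A → (∀ x v, (A x v)ᴴ = -(A x v) ∧ (A x v).trace = 0) → Integrable (ymDensityOfBasis (EuclideanSpace.basisFun (Fin 4) ℝ) A) → Integrable (fun x => (((curvature A x (EuclideanSpace.single (0 : Fin 4) (1 : ℝ)) (EuclideanSpace.single (1 : Fin 4) (1 : ℝ))) * (curvature A x (EuclideanSpace.single (2 : Fin 4) (1 : ℝ)) (EuclideanSpace.single (3 : Fin 4) (1 : ℝ)))).trace - ((curvature A x (EuclideanSpace.single (0 : Fin 4) (1 : ℝ)) (EuclideanSpace.single (2 : Fin 4) (1 : ℝ))) * (curvature A x (EuclideanSpace.single (1 : Fin 4) (1 : ℝ)) (EuclideanSpace.single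 (3 : Fin 4) (1 : ℝ)))).trace + ((curvature A x (EuclideanSpace.single (0 : Fin 4) (1 : ℝ)) (EuclideanSpace.single (3 : Fin 4) (1 : ℝ))) * (curvature A x (EuclideanSpace.single (1 : Fin 4) (1 : ℝ)) (EuclideanSpace.single (2 : Fin 4) (1 : ℝ)))).trace).re) → ∫ x, (fun x => (((curvature A x (EuclideanSpace.single (0 : Fin 4) (1 : ℝ)) (EuclideanSpace.single (1 : Fin 4) (1 : ℝ))) * (curvature A x (EuclideanSpace.single (2 : Fin 4) (1 : ℝ)) (EuclideanSpace.single (3 : Fin 4) (1 : ℝ)))).trace - ((curvature A x (EuclideanSpace.single (0 : Fin 4) (1 : ℝ)) (EuclideanSpace.single (2 : Fin 4) (1 : ℝ))) * (curvature A x (EuclideanSpace.single (1 : Fin 4) (1 : ℝ)) (EuclideanSpace.single (3 : Fin 4) (1 : ℝ)))).trace + ((curvature A x (EuclideanSpace.single (0 : Fin 4) (1 : ℝ)) (EuclideanSpace.single (3 : Fin 4) (1 : ℝ))) * (curvature A x (EuclideanSpace.single (1 : Fin 4) (1 : ℝ)) (EuclideanSpace.single (2 : Fin 4) (1 : ℝ)))).trace).re)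 x = 0 → ContDiff ℝ ((⊤ : ℕ∞) : WithTop ℕ∞) ψ → Integrable (fun x => ∑ s, ∑ c, ‖ψ x s c‖ ^ 2) → (∃ x, ψ x ≠ 0) → (∀ x s c, ∑ μ : Fin 4, ∑ s' : Fin 4, euclideanGamma μ s s' * (fderiv ℝ (fun y => ψ y s' c) x (EuclideanSpace.single μ (1 : ℝ)) + ∑ c' : Fin 3, A x (EuclideanSpace.single μ (1 : ℝ)) c c' * ψ x s' c') = 0) → κ * (8 * Real.pi ^ 2) ≤ ∫ x, ymDensityOfBasis (EuclideanSpace.basisFun (Fin 4) ℝ) A x) →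
    ∀ Nf : ℕ, (Nf = 2 ∨ Nf = 3) → ∀ reg : QCDRegularisation Nf, reg.HasMassScaling → (reg.scheme 0 0 0).HasAsymptoticScaling → Filter.Tendsto reg.mcrit Filter.atTop (nhds 0) → ∀ M₀ : ℝ, 0 ≤ M₀ → ∃ b₀ : ℕ, 2 ≤ b₀ ∧ ∃ ℓ : ℝ, 0 < ℓ ∧ ∃ C : ℝ, 0 ≤ C ∧ ∀ m : Fin Nf → ℝ, (∀ f, M₀ + C < m f) → ∀ R : ℝ, 0 < R → (∀ M : ℝ, M₀ < M → ∀ᶠ k : ℕ in Filter.atTop, ∀ S : ℕ, R ≤ reg.a k * (2 * S + 1) → (1 / 4 : ℝ) ≤ (∫ U, (if (fermionDet (wilsonDirac (fundamentalRep (Fin 3)) U (reg.mcrit k - reg.a k * M / reg.Zm k) 1)).re < 0 then (1 : ℝ) else 0) * (∏ f, ‖fermionDet (wilsonDirac (fundamentalRep (Fin 3)) U (reg.mcrit k + reg.a k * m f / reg.Zm k) 1)‖) ∂(wilsonMeasure (d := 4) (L := 2 * S + 1) (fundamentalRep (Fin 3)) (reg.β k))) / (∫ U, (∏ f, ‖fermionDet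 (wilsonDirac (fundamentalRep (Fin 3)) U (reg.mcrit k + reg.a k * m f / reg.Zm k) 1)‖) ∂(wilsonMeasure (d := 4) (L := 2 * S + 1) (fundamentalRep (Fin 3)) (reg.β k)))) → (∀ M : ℝ, M₀ < M → ∀ᶠ k : ℕ in Filter.atTop, ∀ S : ℕ, R ≤ reg.a k * (2 * S + 1) → reg.a k * (2 * S + 1) ≤ 2 * R → (∫ U, (if (fermionDet (wilsonDirac (fundamentalRep (Fin 3)) U (reg.mcrit k + reg.a k * M / reg.Zm k) 1)).re < 0 then (1 : ℝ) else 0) * (∏ f, ‖fermionDet (wilsonDirac (fundamentalRep (Fin 3)) U (reg.mcrit k + reg.a k * m f / reg.Zm k) 1)‖) ∂(wilsonMeasure (d := 4) (L := 2 * S + 1) (fundamentalRep (Fin 3)) (reg.β k))) / (∫ U, (∏ f, ‖fermionDet (wilsonDirac (fundamentalRep (Fin 3)) U (reg.mcrit k + reg.a k * m f / reg.Zm k) 1)‖) ∂(wilsonMeasure (d := 4) (L := 2 * S + 1) (fundamentalRep (Fin 3)) (reg.β k))) ≤ (1 / 8 : ℝ)) → (∀ ε : ℝ, 0 < ε → ∀ᶠ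 k : ℕ in Filter.atTop, ∀ S : ℕ, R ≤ reg.a k * (2 * S + 1) → ∃ δ : ℕ → ℝ, (∀ j, 0 ≤ δ j) ∧ ∑ j ∈ Finset.range (Nat.log 2 (⌊ℓ / reg.a k⌋₊ / b₀) + 1), δ j ≤ ε ∧ ∀ j < (Nat.log 2 (⌊ℓ / reg.a k⌋₊ / b₀) + 1), ∀ s : Fin 4 → ℕ, (∀ i, b₀ * 2 ^ j ≤ s i ∧ s i < b₀ * 2 ^ (j + 2) ∧ s i ≤ 2 * S + 1 ∧ (s i : ℝ) * reg.a k ≤ ℓ) → ∀ E : GaugeConfig 4 (2 * S + 1) (Matrix.specialUnitaryGroup (Fin 3) ℂ) → Prop, (∀ U, E U → ∃ f : Fin Nf, ∃ μ' : ℝ, reg.mcrit k + reg.a k * m f / reg.Zm k ≤ μ' ∧ ((wilsonCell U μ' 0 s).det = 0 ∨ ∃ c : Fin 4 → Bool, (wilsonCell U μ' (halfCorner s c) (halfSides s c)).det = 0)) → (∫ U, (if E U then (1 : ℝ) else 0) * (∏ f, ‖fermionDet (wilsonDirac (fundamentalRep (Fin 3)) U (reg.mcrit k + reg.a k * m f /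 reg.Zm k) 1)‖) ∂(wilsonMeasure (d := 4) (L := 2 * S + 1) (fundamentalRep (Fin 3)) (reg.β k))) / (∫ U, (∏ f, ‖fermionDet (wilsonDirac (fundamentalRep (Fin 3)) U (reg.mcrit k + reg.a k * m f / reg.Zm k) 1)‖) ∂(wilsonMeasure (d := 4) (L := 2 * S + 1) (fundamentalRep (Fin 3)) (reg.β k))) ≤ δ j) := by
  sorry

/-! ## §2 Composition (sorry-free; cites the five stubs by name) -/

/-- **The crux, by name.**  floor := S2 S2a S2b; N2 := S3 floor; N1 := S1; then the strategist's glue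
`N1 → N2 → EarlyCrosserLaw` (inlined from `EarlyCrosserLawSplit.lean`, `EarlyCrosserLaw_of_subs`): `reg`, branch,
`M₀`, pin from N1; `b₀, ℓ, C` from N2 at `M₀`; the crux's threshold is `M₀ + C`; for `m > M₀ + C` take N1's `R`;
(a′) from N2 at the pinned data; (b), (b″) by monotonicity of the threshold. -/
theorem EarlyCrosserLaw_of : EarlyCrosserLaw := by
  have hfloor := zeroModeActionFloor_of stub_sobolevFourR4 stub_diracKato
  have h₁ := stub_pinnedPhysicalLine
  have h₂ := stub_diluteOfActionFloor hfloor
  intro Nf hNf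
  obtain ⟨reg, hms, has, hbr, M₀, hM₀, hpin⟩ := h₁ Nf hNf
  obtain ⟨b₀, hb₀, ℓ, hℓ, C, hC, hcov⟩ := h₂ Nf hNf reg hms has hbr M₀ hM₀
  refine ⟨reg, hms, has, M₀ + C, by positivity, b₀, hb₀, ℓ, hℓ, fun m hm => ?_⟩
  have hm' : ∀ f, M₀ < m f := fun f => by linarith [hm f]
  obtain ⟨R, hR, hlow, hup⟩ := hpin m hm'
  have hdil := hcov m hm R hR hlow hup
  refine ⟨R, hR, ?_, ?_, ?_⟩
  · exact hdil
  · intro M hM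
    exact hlow M (by linarith)
  · intro M hM
    exact hup M (by linarith)

end Summit.QuantumFields.QCD.Cruxes.EarlyCrosserLaw.ZeroModeFloorDiluteGas

end
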